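import Summits.Schanuel.Schanuel.Theorems.ZilberEacMovingTargetClassification
import Summits.Schanuel.Schanuel.Theorems.ZilberEacDensityRealSlope
import Literature.ModelTheory.Zilber.EACDensityPhases
import HarnessLib

/-!
# Mantova–Masser's typed density question DECIDED on the ENTIRE univariate moving-target family

Zilber's Exponential-Algebraic Closedness, case ladder (host summit Schanuel, cell `pub-schanuel`,
seat 2, gen 9).  THE FAMILY: for ARBITRARY `p, A, F ∈ ℂ[x]`,

  `W(p; A, F) = {x₁ = p(x₀), y₀ = A(x₀) + y₁ F(y₁)} ⊆ ℂ² × ℂ²`  (`movingGraphSurface p A (F.toMv 0)`),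

whose exponential points are the solutions of `e^{z} = A(z) + e^{p(z)} F(e^{p(z)})`.

`ZilberEacMovingTargetClassification` (gen 8) answered Mantova–Masser's question AS TYPED
(`MMCaseDimPiOneFree W → UnprojectedDense W`, `EACDensityQuestion`) by YES for every `p`, every
NON-CONSTANT `A` and every `F`, and left the lines with CONSTANT `A` and `F ≠ 0` open
(e.g. `e^{z} = 1 + e^{√2 z}`).  This file closes that gap and states the COMPLETE answer:

* `movingGraphSurface_C_eq_graphPolySurface` — the bridge: for constant `A = c` the surface
  `W(p; c, F)` IS seat 1's split graph surface `{x₁ = p(x₀), y₀ = q(y₁)}` with `q = c + X F`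
  (`graphPolySurface p (C c + X F)`), for every `p`;
* `mmQuestion_movingTarget_of_ne` — for ALL `p, A, F` with `A` non-constant OR `F ≠ 0`:
  `MMCaseDimPiOneFree W → UnprojectedDense W` (YES);
* `unprojectedDense_movingTarget_iff_of_mmCase` — for ALL `p, A, F`, if `W` is in the case then
  `UnprojectedDense W ↔ (deg A ≥ 1 ∨ F ≠ 0 ∨ {e^{p(log A₀ + 2πik)} : k ∈ ℤ} is infinite)`
  (`A₀ = A(0)`); the last alternative is seat 1's phase dichotomy `unprojectedDense_const_iff_infinite`
  for the constant-fibre surfaces `{x₁ = p(x₀), y₀ = c}`, where BOTH answers occur (the resonant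
  parabola `{x₁ = x₀²/(2πi), y₀ = 1}` is in the case and NOT dense, `EACDensityOscillatory`);
* `mmFreeQuestion_movingTarget` — the repaired (multiplicatively free) question: YES on the whole
  family, all `p, A, F` (freeness excludes exactly the sub-family `A` constant, `F = 0`).

So on this 3-parameter family the typed question is decided completely, with the exceptional set
named: `A` constant ∧ `F = 0` ∧ all phases of `p` at `log A₀` rational.

HONEST FRAMING: a complete answer on one explicit polynomial family to an auxiliary question of
Mantova–Masser (PLMS 2024, §1 "Further remarks"); the inputs are the cell's earlier theorems (line
family of every slope and fibre, exp–exp balance, pure moving target, phase dichotomy); modest EAC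
rungs; `EC(3,2)` OPEN; NOT Schanuel's conjecture; EAC ⇏ SC.
-/

noncomputable section

open Complex MvPolynomial Filter Topology
open Literature.NumberTheory.Transcendental Literature.ModelTheory.Zilber

set_option linter.dupNamespace false

namespace Summit.Schanuel.Schanuel.Theorems

/-! ## The bridge to the split graph surfaces -/

/-- **Bridge.** For a CONSTANT additive target `A = c` the moving-target surface is split:
`W(p; c, F) = {x₁ = p(x₀), y₀ = c + y₁F(y₁)} = graphPolySurface p (C c + X F)`. [folklore] -/
theorem movingGraphSurface_C_eq_graphPolySurface (p : Polynomial ℂ) (c : ℂ) (F : Polynomial ℂ) :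
    movingGraphSurface p (Polynomial.C c) (F.toMvPolynomial 0) =
      graphPolySurface p (Polynomial.C c + Polynomial.X * F) := by
  ext z
  rw [mem_movingGraphSurface_iff, mem_graphPolySurface_iff, MvPolynomial.eval_toMvPolynomial,
    Polynomial.eval_C, Polynomial.eval_add, Polynomial.eval_C, Polynomial.eval_mul,
    Polynomial.eval_X, Matrix.cons_val_zero]

/-- The constant-fibre case `F = 0`: `W(p; c, 0) = {x₁ = p(x₀), y₀ = c} = graphPolySurface p (C c)`,
seat 1's phase-dichotomy family (`EACDensityPhases`). [folklore] -/
theorem movingGraphSurface_C_zero_eq_graphPolySurface (p : Polynomial ℂ) (c : ℂ) :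
    movingGraphSurface p (Polynomial.C c) 0 = graphPolySurface p (Polynomial.C c) := by
  have h := movingGraphSurface_C_eq_graphPolySurface p c 0
  rwa [map_zero, mul_zero, add_zero] at h

/-! ## Constant targets over lines: the gap of gen 8 closed -/

/-- **Lines with constant additive target, every `F`** (`W = {x₁ = a x₀ + b, y₀ = c + y₁F(y₁)}`,
e.g. `e^{z} = 1 + e^{√2 z}`): in the case ⟹ dense — by the bridge this is the cell's theorem on the
line family `{x₁ = a x₀ + b, y₀ = q(y₁)}` for every slope `a ∉ ℚ` and every fibre `q ≠ 0`
(`unprojectedDense_lineSurface_of_mmCase`: non-real slopes by escape, real irrational slopes by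
Kronecker + minimum modulus). (new) [cite: MantovaMasser2023, §1 Further remarks] -/
theorem unprojectedDense_movingTarget_line_const_of_mmCase (a b c : ℂ) (F : Polynomial ℂ)
    (hcase : MMCaseDimPiOneFree
      (movingGraphSurface (linePoly a b) (Polynomial.C c) (F.toMvPolynomial 0))) :
    UnprojectedDense (movingGraphSurface (linePoly a b) (Polynomial.C c) (F.toMvPolynomial 0)) := by
  rw [movingGraphSurface_C_eq_graphPolySurface] at hcase ⊢
  exact unprojectedDense_lineSurface_of_mmCase a b _ hcase

/-- **Mantova–Masser's question AS TYPED: YES for all `p, A, F ∈ ℂ[x]` with `A` non-constant or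
`F ≠ 0`.**  If `W(p; A, F)` is in case (dim-pi-S-1-free) then its exponential points are Zariski
dense.  (Non-constant `A`: `mmQuestion_movingTarget`; constant `A`, `F ≠ 0`: `deg p ≥ 2` by the
exp–exp balance `unprojectedDense_movingTarget_of_two_le`, `deg p ≤ 1` by the bridge.) (new)
[cite: MantovaMasser2023, §1 Further remarks] -/
theorem mmQuestion_movingTarget_of_ne (p A F : Polynomial ℂ) (h : 0 < A.natDegree ∨ F ≠ 0)
    (hcase : MMCaseDimPiOneFree (movingGraphSurface p A (F.toMvPolynomial 0))) :
    UnprojectedDense (movingGraphSurface p A (F.toMvPolynomial 0)) := by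
  rcases Nat.eq_zero_or_pos A.natDegree with hA | hA
  · have hF : F ≠ 0 := h.resolve_left (by omega)
    rcases Nat.lt_or_ge p.natDegree 2 with hlt | hge
    · have hpeq : p = linePoly (p.coeff 1) (p.coeff 0) :=
        Polynomial.eq_X_add_C_of_natDegree_le_one (by omega)
      have hAeq : A = Polynomial.C (A.coeff 0) := Polynomial.eq_C_of_natDegree_eq_zero hA
      rw [hpeq, hAeq] at hcase ⊢
      exact unprojectedDense_movingTarget_line_const_of_mmCase _ _ _ F hcase
    · exact unprojectedDense_movingTarget_of_two_le hge (Or.inl hF)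
  · exact mmQuestion_movingTarget p hA F hcase

/-- **The repaired (free) question: YES on the whole family.**  For ALL `p, A, F ∈ ℂ[x]`: case ∧
multiplicatively free torus part ⟹ dense (freeness with `F = 0` forces `A` non-constant,
`natDegree_pos_of_mmCase_of_isMulFree_zero`). (new) [cite: MantovaMasser2023, §1 Further remarks] -/
theorem mmFreeQuestion_movingTarget (p A F : Polynomial ℂ)
    (hcase : MMCaseDimPiOneFree (movingGraphSurface p A (F.toMvPolynomial 0)))
    (hfree : IsMulFree ℂ 2 (movingGraphSurface p A (F.toMvPolynomial 0) ∩ torusLocus ℂ 2)) :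
    UnprojectedDense (movingGraphSurface p A (F.toMvPolynomial 0)) := by
  by_cases hF : F = 0
  · subst hF
    have hA : 0 < A.natDegree := by
      rw [map_zero] at hcase hfree
      exact natDegree_pos_of_mmCase_of_isMulFree_zero hcase hfree
    exact mmQuestion_movingTarget_of_ne p A 0 (Or.inl hA) hcase
  · exact mmQuestion_movingTarget_of_ne p A F (Or.inr hF) hcase

/-! ## The exceptional sub-family and the complete answer -/

/-- **The exceptional sub-family** `A = c` constant, `F = 0` (`W = {x₁ = p(x₀), y₀ = c}`,
`c = e^{z₀}`): dense iff the set `{e^{p(z₀ + 2πik)} : k ∈ ℤ}` is infinite — seat 1's phase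
dichotomy `unprojectedDense_const_iff_infinite` through the bridge. [folklore]
[cite: MantovaMasser2023, §1 Further remarks] -/
theorem unprojectedDense_movingTarget_const_zero_iff (p : Polynomial ℂ) {z₀ c : ℂ}
    (hc : exp z₀ = c) :
    UnprojectedDense (movingGraphSurface p (Polynomial.C c) 0) ↔
      Set.Infinite (Set.range fun k : ℤ => exp (p.eval (z₀ + k * (2 * Real.pi * I)))) := by
  rw [movingGraphSurface_C_zero_eq_graphPolySurface]
  exact unprojectedDense_const_iff_infinite hc

/-- **THE COMPLETE ANSWER on the univariate moving-target family.**  For ALL `p, A, F ∈ ℂ[x]`: if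
`W(p; A, F) = {x₁ = p(x₀), y₀ = A(x₀) + y₁F(y₁)}` is in Mantova–Masser's case (dim-pi-S-1-free),
then its exponential points are Zariski dense in `W` if and only if

  `deg A ≥ 1`  ∨  `F ≠ 0`  ∨  `{e^{p(log A₀ + 2πik)} : k ∈ ℤ}` is infinite  (`A₀ = A(0)`),

i.e. the ONLY members of the family in the case without dense exponential points are the
constant-fibre surfaces `{x₁ = p(x₀), y₀ = c}` all of whose phases are rational (seat 1's resonant
surfaces, e.g. `{x₁ = x₀²/(2πi), y₀ = 1}`). (new) [cite: MantovaMasser2023, §1 Further remarks] -/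
theorem unprojectedDense_movingTarget_iff_of_mmCase (p A F : Polynomial ℂ)
    (hcase : MMCaseDimPiOneFree (movingGraphSurface p A (F.toMvPolynomial 0))) :
    UnprojectedDense (movingGraphSurface p A (F.toMvPolynomial 0)) ↔
      (0 < A.natDegree ∨ F ≠ 0 ∨
        Set.Infinite (Set.range fun k : ℤ =>
          exp (p.eval (Complex.log (A.coeff 0) + k * (2 * Real.pi * I))))) := by
  by_cases h : 0 < A.natDegree ∨ F ≠ 0
  · exact ⟨fun _ => h.elim Or.inl (fun hF => Or.inr (Or.inl hF)),
      fun _ => mmQuestion_movingTarget_of_ne p A F h hcase⟩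
  · have hA : A.natDegree = 0 := by
      by_contra hA
      exact h (Or.inl (Nat.pos_of_ne_zero hA))
    have hF : F = 0 := by
      by_contra hF
      exact h (Or.inr hF)
    subst hF
    obtain ⟨c, rfl⟩ : ∃ c, A = Polynomial.C c := ⟨A.coeff 0, Polynomial.eq_C_of_natDegree_eq_zero hA⟩
    rw [map_zero] at hcase ⊢
    have hc0 : c ≠ 0 := by
      rw [movingGraphSurface_C_zero_eq_graphPolySurface] at hcase
      exact Polynomial.C_ne_zero.1 (ne_zero_of_graphPolySurface_inter_torusLocus_nonempty hcase.2.1)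
    rw [Polynomial.coeff_C_zero, Polynomial.natDegree_C,
      unprojectedDense_movingTarget_const_zero_iff p (Complex.exp_log hc0)]
    simp

/-- The same with the three regimes spelled out as a disjunction of the cell's certificates: in the
case, `W(p; A, F)` is dense unless `A` is constant and `F = 0`; and on that sub-family density is
seat 1's phase condition. (new) [cite: MantovaMasser2023, §1 Further remarks] -/
theorem not_unprojectedDense_movingTarget_iff_of_mmCase (p A F : Polynomial ℂ)
    (hcase : MMCaseDimPiOneFree (movingGraphSurface p A (F.toMvPolynomial 0))) :
    ¬ UnprojectedDense (movingGraphSurface p A (F.toMvPolynomial 0)) ↔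
      (A.natDegree = 0 ∧ F = 0 ∧
        Set.Finite (Set.range fun k : ℤ =>
          exp (p.eval (Complex.log (A.coeff 0) + k * (2 * Real.pi * I))))) := by
  rw [unprojectedDense_movingTarget_iff_of_mmCase p A F hcase]
  push Not
  simp only [Nat.le_zero]

/-! ## Examples -/

/-- `C 1 + X * 1 ≠ 0` in `ℂ[x]`. [folklore] -/
theorem C_one_add_X_mul_one_ne_zero : (Polynomial.C 1 + Polynomial.X * 1 : Polynomial ℂ) ≠ 0 := by
  intro h
  have h0 := congrArg (Polynomial.eval 0) h
  simp at h0

/-- **Example (the gap of gen 8): `e^{z} = 1 + e^{√2 z}`** — the surface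
`{x₁ = √2 x₀, y₀ = 1 + y₁}` as the moving-target surface `W(√2 X; 1, 1)`: dense. (new) -/
theorem unprojectedDense_exp_eq_one_add_exp_sqrt_two :
    UnprojectedDense (movingGraphSurface (linePoly (Real.sqrt 2 : ℂ) 0) (Polynomial.C 1)
      ((1 : Polynomial ℂ).toMvPolynomial 0)) := by
  rw [movingGraphSurface_C_eq_graphPolySurface]
  exact unprojectedDense_lineSurface_of_forall_rat_ne (forall_rat_ne_coe_iff.2 irrational_sqrt_two) 0
    C_one_add_X_mul_one_ne_zero

/-- … and it is in the case (slope `√2 ∉ ℚ`), so it is a positive instance of the typed question: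
case ∧ dense. (new) -/
theorem unprojectedDensityQuestion_instance_exp_eq_one_add_exp_sqrt_two :
    MMCaseDimPiOneFree (movingGraphSurface (linePoly (Real.sqrt 2 : ℂ) 0) (Polynomial.C 1)
      ((1 : Polynomial ℂ).toMvPolynomial 0)) ∧
    UnprojectedDense (movingGraphSurface (linePoly (Real.sqrt 2 : ℂ) 0) (Polynomial.C 1)
      ((1 : Polynomial ℂ).toMvPolynomial 0)) := by
  refine ⟨?_, unprojectedDense_exp_eq_one_add_exp_sqrt_two⟩
  rw [movingGraphSurface_C_eq_graphPolySurface]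
  exact (mmCase_graphPolySurface_line_iff _ _ C_one_add_X_mul_one_ne_zero).2
    (forall_rat_ne_coe_iff.2 irrational_sqrt_two)

/-- **Example (the exceptional sub-family, NO): the resonant parabola** `{x₁ = x₀²/(2πi), y₀ = 1}`
as `W(X²/(2πi); 1, 0)`: in the case and NOT dense (seat 1, `not_unprojectedDense_resonantParabola`).
[folklore] -/
theorem not_unprojectedDense_movingTarget_resonantParabola :
    MMCaseDimPiOneFree (movingGraphSurface resonantPoly (Polynomial.C 1) 0) ∧
      ¬ UnprojectedDense (movingGraphSurface resonantPoly (Polynomial.C 1) 0) := by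
  rw [movingGraphSurface_C_zero_eq_graphPolySurface]
  exact ⟨mmCase_resonantParabola, not_unprojectedDense_resonantParabola⟩

end Summit.Schanuel.Schanuel.Theorems

end
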